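import Literature.Geometry.Kaehler.HolomorphicLineBundleCechSmoothing
import HarnessLib

/-!
# The degree-one Leray lemma for `𝒪(L)`: a `1`-cocycle on a finer cover comes from any coarser cover by `∂̄`-acyclic sets (II)

Layer `Literature/Geometry/Kaehler`, second half of the smoothing lemma for the sheaf `𝒪(L)` of
sections of a cocycle line bundle (`HolomorphicLineBundleCechSmoothing`). Setting: a framed cover
`𝔙' = (V'_i, frame i)` of `M` for `L` whose members are `∂̄`-ACYCLIC in bidegrees `(0, ≥ 1)`
(`IsDolbeaultAcyclic`, e.g. chart-convex sets — the `∂̄`-Poincaré lemma of the tree), shrunk on the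
same index set to a cover `𝔙 = (V_i ⊆ V'_i)` of `M`, and a smooth partition of unity subordinate to
`𝔙`. For a holomorphic `1`-cocycle `z` of `𝒪(L)` on `𝔙`:

* `FramedCover.extendForm` — the `L`-valued `∂̄`-closed `(0,1)`-form of `z` read in the frame of
  `V'_i` over ALL of `V'_i`: `Ω_i = Σ_l ρ_l g_{frame l, frame i} ∂̄ b_l` (the `∂̄ b_l` of the smooth
  contraction glue, `coordChange_smul_dbarContract`, so `Ω_i = g_{frame l, frame i} ∂̄ b_l` wherever
  `V_l` meets `V'_i`); `extendForm_mem` (`Ω_i ∈ A^{0,1}(V'_i)`), `extendForm_apply_eq` (the local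
  expression), `coordChange_smul_extendForm` (twisted gluing on `V'_i ∩ V'_j`), `extendForm_apply_eq_dbarContract`
  (`Ω_i = ∂̄ b_i` on `V_i`) and `localDbar_extendForm` (`∂̄ Ω_i = 0`, as `Ω_i` is locally `∂̄(g b_l)`);
* **`FramedCover.exists_cocycle_res_eq_add_delta`** — THE LEMMA: there are a holomorphic `1`-cocycle
  `x` of `𝒪(L)` on the coarse cover `𝔙'` and a holomorphic `0`-cochain `w` on `𝔙` with
  **`x|_𝔙 = z + δ w`**. Proof: `∂̄ h_i = Ω_i` on `V'_i` by acyclicity; `x_{(i,j)} = g_{frame j, frame i} h_j - h_i`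
  is holomorphic (`∂̄ x_{(i,j)} = g Ω_j - Ω_i = 0`, Cauchy–Riemann on open sets) and a cocycle;
  `w_i = h_i - b_i` is holomorphic on `V_i` (`∂̄ w_i = Ω_i - ∂̄ b_i = 0`); and
  `z_{(i,j)} + (δ w)_{(i,j)} = (g b_j - b_i) + g (h_j - b_j) - (h_i - b_i) = x_{(i,j)}`.
  (O. Forster, *Lectures on Riemann Surfaces* (1981), §12.6–12.8 and Lemma 14.7 without the norm
  estimate; Grauert–Remmert (1977), Kap. VI §4.3; this is the surjectivity `H¹(𝔙', 𝒪(L)) → H¹(𝔙, 𝒪(L))`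
  of Leray's theorem in degree one, the two inputs `exists_resZ_resZ_eq_add_deltaZ` / `exists_cls_resZ_eq`
  of the tree's abstract Cartan–Serre finiteness theorem `Module.finite_of_compact_restriction`.)

Everything is proved; the only definition is `extendForm`.

## References

* O. Forster, *Lectures on Riemann Surfaces*, GTM 81 (1981), §12.6–12.8, Lemma 14.7. [Forster1981]
* H. Grauert, R. Remmert, *Theorie der Steinschen Räume* (1977), Kap. VI §4.3. [GrauertRemmert1977]
* C. Voisin, *Hodge Theory and Complex Algebraic Geometry I* (2002), Thm. 4.41, Prop. 2.36. [VoisinHodgeI2002]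
-/

noncomputable section

open scoped Manifold ContDiff Topology
open Set Filter Function Literature.NumberTheory.Transcendental

namespace Literature.Geometry.Kaehler

variable {ι κ : Type*} {E : Type*} [NormedAddCommGroup E] [NormedSpace ℂ E]
  {M : Type*} [TopologicalSpace M] [ChartedSpace E M]

/-- Pointwise multiplication by a complex function preserves the type of a form. [cite: VoisinHodgeI2002, §2.3.1] -/
theorem _root_.Literature.NumberTheory.Transcendental.IsOfType.cmul {k p q : ℕ} (f : M → ℂ)
    {α : MForm 𝓘(ℝ, E) M ℂ k} (hα : IsOfType p q α) : IsOfType p q (MForm.cmul f α) :=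
  ⟨hα.1, fun x θ v ↦ by
    simp only [MForm.cmul_apply, ContinuousAlternatingMap.smul_apply, hα.2 x θ v, smul_eq_mul]
    ring⟩

/-- A `0`-form is the `0`-form of its value on the empty tuple. [folklore] -/
theorem MForm.ofFun_apply_vecEmpty (α : MForm 𝓘(ℝ, E) M ℂ 0) :
    (MForm.ofFun 𝓘(ℝ, E) fun y ↦ α y ![]) = α := by
  funext y
  ext v
  rw [MForm.ofFun_apply, Subsingleton.elim ![] v]

namespace HolomorphicLineBundle

namespace FramedCover

variable {L : HolomorphicLineBundle ι E M} (C' : L.FramedCover κ) (U : κ → Set M)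
  (hU : ∀ k, IsOpen (U k)) (hUC : ∀ k, U k ⊆ C'.U k)
  [Fintype κ] (ρ : SmoothPartitionOfUnity κ 𝓘(ℝ, E) M univ) (hρ : ρ.IsSubordinate (C'.shrink U hU hUC).U)
  [FiniteDimensional ℂ E] [T2Space M] [IsManifold 𝓘(ℂ, E) ω M] [IsManifold 𝓘(ℝ, E) ∞ M]

/-! ### The `L`-valued `(0,1)`-form of a cocycle, read over the coarse sets -/

/-- **The extension `Ω_i = Σ_l ρ_l · g_{frame l, frame i} · ∂̄ b_l`**, cut off to `V'_i`: the
`∂̄`-closed `(0,1)`-form on the COARSE set `V'_i` (in the frame `σ_{frame i}`) glued from the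
`∂̄ b_l` of the smooth contraction of `z` on the fine cover. [cite: Forster1981, Lemma 14.7] -/
def extendForm (z : (C'.shrink U hU hUC).Cochain 1) (i : κ) : MForm 𝓘(ℝ, E) M ℂ (0 + (0 + 1)) :=
  ∑ l, (MForm.cmul (fun y ↦ (ρ l y : ℂ) * L.coordChange (C'.frame l) (C'.frame i) y)
    ((C'.shrink U hU hUC).dbarContract ρ hρ z l : MForm 𝓘(ℝ, E) M ℂ (0 + (0 + 1)))).restr (C'.U i)

/-- The extension at a point of `V'_i`. [folklore] -/
theorem extendForm_apply_of_mem (z : (C'.shrink U hU hUC).Cochain 1) (i : κ) {y : M} (hy : y ∈ C'.U i) :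
    C'.extendForm U hU hUC ρ hρ z i y = ∑ l, ((ρ l y : ℂ) * L.coordChange (C'.frame l) (C'.frame i) y) •
      ((C'.shrink U hU hUC).dbarContract ρ hρ z l : MForm 𝓘(ℝ, E) M ℂ (0 + (0 + 1))) y := by
  rw [extendForm, Finset.sum_apply]
  refine Finset.sum_congr rfl fun l _ ↦ ?_
  rw [MForm.restr_apply_of_mem _ hy, MForm.cmul_apply]

/-- The extension vanishes off `V'_i`. [folklore] -/
theorem extendForm_apply_of_notMem (z : (C'.shrink U hU hUC).Cochain 1) (i : κ) {y : M} (hy : y ∉ C'.U i) :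
    C'.extendForm U hU hUC ρ hρ z i y = 0 := by
  rw [extendForm, Finset.sum_apply]
  exact Finset.sum_eq_zero fun l _ ↦ MForm.restr_apply_of_notMem _ hy

/-- **The local expression of the extension**: at a point `y ∈ V'_i ∩ V_{l₀}`,
`Ω_i(y) = g_{frame l₀, frame i}(y) (∂̄ b_{l₀})_y` (gluing of the `∂̄ b_l` and `Σ ρ_l = 1`), for a
cocycle `z`. [cite: Forster1981, Lemma 14.7] -/
theorem extendForm_apply_eq {z : (C'.shrink U hU hUC).Cochain 1} (hz : (C'.shrink U hU hUC).delta 1 z = 0)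
    (i l₀ : κ) {y : M} (hy : y ∈ C'.U i) (hy₀ : y ∈ U l₀) :
    C'.extendForm U hU hUC ρ hρ z i y = L.coordChange (C'.frame l₀) (C'.frame i) y •
      ((C'.shrink U hU hUC).dbarContract ρ hρ z l₀ : MForm 𝓘(ℝ, E) M ℂ (0 + (0 + 1))) y := by
  rw [C'.extendForm_apply_of_mem U hU hUC ρ hρ z i hy]
  have hterm : ∀ l, ((ρ l y : ℂ) * L.coordChange (C'.frame l) (C'.frame i) y) •
      ((C'.shrink U hU hUC).dbarContract ρ hρ z l : MForm 𝓘(ℝ, E) M ℂ (0 + (0 + 1))) y =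
      (ρ l y : ℂ) • (L.coordChange (C'.frame l₀) (C'.frame i) y •
        ((C'.shrink U hU hUC).dbarContract ρ hρ z l₀ : MForm 𝓘(ℝ, E) M ℂ (0 + (0 + 1))) y) := by
    intro l
    by_cases hyl : y ∈ U l
    · -- `g_{l,i} = g_{l₀,i} g_{l,l₀}` and `g_{l,l₀} ∂̄b_l = ∂̄b_{l₀}`
      have hglue := (C'.shrink U hU hUC).coordChange_smul_dbarContract ρ hρ hz l₀ l ⟨hy₀, hyl⟩
      have hg : L.coordChange (C'.frame l) (C'.frame i) y =
          L.coordChange (C'.frame l₀) (C'.frame i) y * L.coordChange (C'.frame l) (C'.frame l₀) y := by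
        rw [mul_comm]
        exact (L.coordChange_comp _ _ _ y ⟨⟨(hUC l).trans (C'.subset l) hyl,
          (hUC l₀).trans (C'.subset l₀) hy₀⟩, C'.subset i hy⟩).symm
      rw [← hglue, smul_smul, smul_smul, hg, mul_assoc]
      rfl
    · rw [rho_apply_eq_zero ρ hρ hyl, Complex.ofReal_zero, zero_mul, zero_smul, zero_smul]
  rw [Finset.sum_congr rfl fun l _ ↦ hterm l, ← Finset.sum_smul, ← Complex.ofReal_sum, sum_rho_apply,
    Complex.ofReal_one, one_smul]

/-- **Twisted gluing of the extensions**: `g_{frame j, frame i}(y) Ω_j(y) = Ω_i(y)` on `V'_i ∩ V'_j`.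
[cite: Forster1981, Lemma 14.7] -/
theorem coordChange_smul_extendForm (hcov : ∀ x : M, ∃ k, x ∈ U k) {z : (C'.shrink U hU hUC).Cochain 1}
    (hz : (C'.shrink U hU hUC).delta 1 z = 0) (i j : κ) {y : M} (hy : y ∈ C'.U i ∩ C'.U j) :
    L.coordChange (C'.frame j) (C'.frame i) y • C'.extendForm U hU hUC ρ hρ z j y =
      C'.extendForm U hU hUC ρ hρ z i y := by
  obtain ⟨l₀, hl₀⟩ := hcov y
  rw [C'.extendForm_apply_eq U hU hUC ρ hρ hz j l₀ hy.2 hl₀, C'.extendForm_apply_eq U hU hUC ρ hρ hz i l₀ hy.1 hl₀,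
    smul_smul, mul_comm, L.coordChange_comp _ _ _ y ⟨⟨(hUC l₀).trans (C'.subset l₀) hl₀, C'.subset j hy.2⟩,
      C'.subset i hy.1⟩]

/-- **On the fine set `V_i` the extension is `∂̄ b_i`.** [cite: Forster1981, Lemma 14.7] -/
theorem extendForm_apply_eq_dbarContract {z : (C'.shrink U hU hUC).Cochain 1}
    (hz : (C'.shrink U hU hUC).delta 1 z = 0) (i : κ) {y : M} (hy : y ∈ U i) :
    C'.extendForm U hU hUC ρ hρ z i y =
      ((C'.shrink U hU hUC).dbarContract ρ hρ z i : MForm 𝓘(ℝ, E) M ℂ (0 + (0 + 1))) y := by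
  rw [C'.extendForm_apply_eq U hU hUC ρ hρ hz i i (hUC i hy) hy,
    L.coordChange_self _ ((hUC i).trans (C'.subset i) hy), one_smul]

/-- **The extension is a `(0,1)`-form on `V'_i`** (smooth there: each term is a cut-off supported in
`V_l` times a form smooth on `V_l ∩ V'_i`; type `(0,1)`; zero off `V'_i`).
[cite: Forster1981, Lemma 14.7] -/
theorem extendForm_mem (z : (C'.shrink U hU hUC).Cochain 1) (i : κ) :
    C'.extendForm U hU hUC ρ hρ z i ∈ pqFormsOn E M (C'.U i) 0 1 := by
  refine Submodule.sum_mem _ fun l _ ↦ ⟨fun y hy ↦ ?_, fun y hy ↦ MForm.restr_apply_of_notMem _ hy,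
    (((C'.shrink U hU hUC).dbarContract ρ hρ z l).2.2.2.cmul _).restr _⟩
  -- smoothness at `y ∈ V'_i` of the `l`-th term
  have hsm : (MForm.cmul (fun y ↦ (ρ l y : ℂ) * L.coordChange (C'.frame l) (C'.frame i) y)
      ((C'.shrink U hU hUC).dbarContract ρ hρ z l : MForm 𝓘(ℝ, E) M ℂ (0 + (0 + 1)))).SmoothAt y := by
    by_cases hys : y ∈ tsupport (ρ l)
    · have hyl : y ∈ U l := hρ l hys
      have hg : ContMDiffAt 𝓘(ℝ, E) 𝓘(ℝ, ℂ) ∞ (L.coordChange (C'.frame l) (C'.frame i)) y :=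
        (contMDiffOn_real_of_mdifferentiableOn_complex (L.mdifferentiableOn_coordChange _ _)
          ((L.isOpen_baseSet _).inter (L.isOpen_baseSet _))).contMDiffAt
          (((L.isOpen_baseSet _).inter (L.isOpen_baseSet _)).mem_nhds
            ⟨(hUC l).trans (C'.subset l) hyl, C'.subset i hy⟩)
      exact MForm.SmoothAt.cmul
        (contMDiffAt_mul_complex' (Complex.ofRealCLM.contMDiff.comp (ρ l).contMDiff).contMDiffAt hg)
        (((C'.shrink U hU hUC).dbarContract ρ hρ z l).2.1 y hyl)
    · refine (MForm.smoothAt_zero y).congr_of_eventuallyEq ?_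
      filter_upwards [notMem_tsupport_iff_eventuallyEq.1 hys] with w hw
      simp only [MForm.cmul_apply, hw, Pi.zero_apply, Complex.ofReal_zero, zero_mul, zero_smul]
  refine hsm.congr_of_eventuallyEq ?_
  filter_upwards [(C'.isOpen i).mem_nhds hy] with w hw
  exact (MForm.restr_apply_of_mem _ hw).symm

/-- **The extension is `∂̄`-closed on `V'_i`**: near a point `y ∈ V'_i ∩ V_{l₀}` it is
`g_{frame l₀, frame i} ∂̄ b_{l₀} = ∂̄ (g b_{l₀})` (`∂̄(g f) = g ∂̄f`), and `∂̄ ∘ ∂̄ = 0` on the open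
set `V'_i ∩ V_{l₀}`. [cite: Forster1981, Lemma 14.7] -/
theorem localDbar_extendForm (hcov : ∀ x : M, ∃ k, x ∈ U k) {z : (C'.shrink U hU hUC).Cochain 1}
    (hz : (C'.shrink U hU hUC).delta 1 z = 0) (i : κ) :
    localDbar E M (C'.isOpen i) 0 1 ⟨C'.extendForm U hU hUC ρ hρ z i, C'.extendForm_mem U hU hUC ρ hρ z i⟩ = 0 := by
  refine Subtype.ext (funext fun y ↦ ?_)
  by_cases hy : y ∈ C'.U i
  · obtain ⟨l₀, hl₀⟩ := hcov y
    set O : Set M := C'.U i ∩ U l₀ with hOdef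
    have hO : IsOpen O := (C'.isOpen i).inter (hU l₀)
    have hyO : y ∈ O := ⟨hy, hl₀⟩
    have hg : MDifferentiableOn 𝓘(ℂ, E) 𝓘(ℂ, ℂ) (L.coordChange (C'.frame l₀) (C'.frame i)) O :=
      (L.mdifferentiableOn_coordChange _ _).mono fun w hw ↦
        ⟨(hUC l₀).trans (C'.subset l₀) hw.2, C'.subset i hw.1⟩
    -- the local primitive `Φ = (g b_{l₀})|_O`
    set Φ : ↥(pqFormsOn E M O 0 0) := ⟨(MForm.ofFun 𝓘(ℝ, E) fun w ↦
      L.coordChange (C'.frame l₀) (C'.frame i) w * (C'.shrink U hU hUC).contract ρ z l₀ w).restr O,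
      restr_ofFun_mem_pqFormsOn hO fun w hw ↦ contMDiffAt_mul_complex'
        ((contMDiffOn_real_of_mdifferentiableOn_complex hg hO).contMDiffAt (hO.mem_nhds hw))
        ((C'.shrink U hU hUC).contMDiffAt_contract ρ hρ z l₀ hw.2)⟩ with hΦ
    -- `Ω_i = ∂̄ Φ` near `y`
    have hloc : ∀ᶠ w in 𝓝 y, C'.extendForm U hU hUC ρ hρ z i w =
        (localDbar E M hO 0 0 Φ : MForm 𝓘(ℝ, E) M ℂ (0 + (0 + 1))) w := by
      filter_upwards [hO.mem_nhds hyO] with w hw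
      rw [C'.extendForm_apply_eq U hU hUC ρ hρ hz i l₀ hw.1 hw.2, localDbar_apply_of_mem _ _ hw, hΦ,
        Subtype.coe_mk, dolbeaultBar_restr_apply_of_mem hO _ hw,
        dolbeaultBar_ofFun_mul_of_mdifferentiableOn hO hg hw ((C'.shrink U hU hUC).contMDiffAt_contract ρ hρ z l₀ hw.2),
        (C'.shrink U hU hUC).dbarContract_apply_of_mem ρ hρ z l₀ hw.2]
    have h2 := congr_fun (congr_arg Subtype.val (localDbar_localDbar hO Φ)) y
    rw [localDbar_apply_of_mem _ _ hyO] at h2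
    rw [localDbar_apply_of_mem _ _ hy, Subtype.coe_mk, dolbeaultBar_congr_of_eventuallyEq hloc, h2]
    rfl
  · rw [coe_localDbar, MForm.restr_apply_of_notMem _ hy]
    rfl

/-! ### The lemma -/

omit [Fintype κ] [FiniteDimensional ℂ E] [T2Space M] [IsManifold 𝓘(ℂ, E) ω M] in
/-- A function `C^∞` at the points of a set `W` with `∂̄ = 0` there, cut off to `W`, is an element of
`𝒪(W)`. [cite: VoisinHodgeI2002, §2.3.3 Lemma 2.29] -/
theorem indicator_mem_holFunOn {W : Set M} {F : M → ℂ}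
    (hF : ∀ y ∈ W, ContMDiffAt 𝓘(ℝ, E) 𝓘(ℝ, ℂ) ∞ F y)
    (h0 : ∀ y ∈ W, dolbeaultBar (MForm.ofFun 𝓘(ℝ, E) F) y = 0) : W.indicator F ∈ holFunOn E W :=
  ⟨(mdifferentiableOn_of_dolbeaultBar_ofFun_eq_zero (fun y hy ↦ MForm.smoothAt_ofFun_of_contMDiffAt (hF y hy))
      h0).congr fun _ hy ↦ indicator_of_mem hy _,
    fun _ hy ↦ indicator_of_notMem hy _⟩

/-- **The degree-one Leray lemma for `𝒪(L)`.** Let `𝔙'` be a framed cover of `M` for `L` by sets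
which are `∂̄`-acyclic in bidegrees `(0, ≥ 1)`, shrunk on the same index set to a cover `𝔙` of `M`
(`V_k ⊆ V'_k`). Then every holomorphic `1`-cocycle `z` of `𝒪(L)` on the fine cover `𝔙` is, up to
the coboundary of a holomorphic `0`-cochain `w` on `𝔙`, the restriction of a holomorphic `1`-cocycle
`x` on the coarse cover `𝔙'`: `x|_𝔙 = z + δ w`. In particular `H¹(𝔙', 𝒪(L)) → H¹(𝔙, 𝒪(L))` is
onto. (Forster (1981), §12.6–12.8 / Lemma 14.7 without norms; Grauert–Remmert (1977), Kap. VI §4.3.)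
[cite: Forster1981, Lemma 14.7] -/
theorem exists_cocycle_res_eq_add_delta [SigmaCompactSpace M] (hcov : ∀ x : M, ∃ k, x ∈ U k)
    (hacyc : ∀ i, IsDolbeaultAcyclic E M (C'.isOpen i) 0)
    (z : (C'.shrink U hU hUC).Cochain 1) (hz : (C'.shrink U hU hUC).delta 1 z = 0) :
    ∃ (x : C'.Cochain 1) (w : (C'.shrink U hU hUC).Cochain 0), C'.delta 1 x = 0 ∧
      C'.res U hU hUC 1 x = z + (C'.shrink U hU hUC).delta 0 w := by
  -- a partition of unity subordinate to the fine cover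
  obtain ⟨ρ, hρ⟩ := SmoothPartitionOfUnity.exists_isSubordinate 𝓘(ℝ, E) isClosed_univ U hU
    (fun x _ ↦ mem_iUnion.2 (hcov x))
  -- primitives `h_i` of the extensions on the coarse sets
  have hprim : ∀ i, ∃ H : ↥(pqFormsOn E M (C'.U i) 0 0), localDbar E M (C'.isOpen i) 0 0 H =
      ⟨C'.extendForm U hU hUC ρ hρ z i, C'.extendForm_mem U hU hUC ρ hρ z i⟩ := fun i ↦
    hacyc i 0 _ (C'.localDbar_extendForm U hU hUC ρ hρ hcov hz i)
  choose H hH using hprim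
  set h : κ → M → ℂ := fun i y ↦ (H i : MForm 𝓘(ℝ, E) M ℂ (0 + 0)) y ![] with hh
  have hofFun : ∀ i, MForm.ofFun 𝓘(ℝ, E) (h i) = (H i : MForm 𝓘(ℝ, E) M ℂ (0 + 0)) := fun i ↦
    MForm.ofFun_apply_vecEmpty _
  have hsmooth : ∀ i, ∀ y ∈ C'.U i, ContMDiffAt 𝓘(ℝ, E) 𝓘(ℝ, ℂ) ∞ (h i) y := fun i y hy ↦
    contMDiffAt_of_smoothAt_ofFun (by rw [hofFun]; exact (H i).2.1 y hy)
  have hdbar : ∀ i, ∀ y ∈ C'.U i, dolbeaultBar (MForm.ofFun 𝓘(ℝ, E) (h i)) y =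
      C'.extendForm U hU hUC ρ hρ z i y := fun i y hy ↦ by
    have e := congr_fun (congr_arg Subtype.val (hH i)) y
    rwa [localDbar_apply_of_mem _ _ hy, ← hofFun] at e
  -- the smooth contraction `b = contract ρ z`
  have hbsmooth : ∀ i, ∀ y ∈ U i, ContMDiffAt 𝓘(ℝ, E) 𝓘(ℝ, ℂ) ∞ ((C'.shrink U hU hUC).contract ρ z i) y :=
    fun i y hy ↦ (C'.shrink U hU hUC).contMDiffAt_contract ρ hρ z i hy
  -- the coarse cocycle `x_{(i,j)} = g_{j,i} h_j - h_i`
  have hxmem : ∀ J : Fin 2 → κ, (cechSet C'.U J).indicator (fun y ↦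
      L.coordChange (C'.frame (J 1)) (C'.frame (J 0)) y * h (J 1) y - h (J 0) y) ∈ holFunOn E (cechSet C'.U J) := by
    intro J
    have hW : IsOpen (cechSet C'.U J) := isOpen_cechSet C'.isOpen J
    have h0W : ∀ y ∈ cechSet C'.U J, y ∈ C'.U (J 0) := fun y hy ↦ cechSet_subset_apply C'.U J 0 hy
    have h1W : ∀ y ∈ cechSet C'.U J, y ∈ C'.U (J 1) := fun y hy ↦ cechSet_subset_apply C'.U J 1 hy
    have hg : MDifferentiableOn 𝓘(ℂ, E) 𝓘(ℂ, ℂ) (L.coordChange (C'.frame (J 1)) (C'.frame (J 0)))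
        (cechSet C'.U J) :=
      (L.mdifferentiableOn_coordChange _ _).mono fun y hy ↦ ⟨C'.subset _ (h1W y hy), C'.subset _ (h0W y hy)⟩
    have hgc : ∀ y ∈ cechSet C'.U J, ContMDiffAt 𝓘(ℝ, E) 𝓘(ℝ, ℂ) ∞
        (L.coordChange (C'.frame (J 1)) (C'.frame (J 0))) y := fun y hy ↦
      (contMDiffOn_real_of_mdifferentiableOn_complex hg hW).contMDiffAt (hW.mem_nhds hy)
    refine indicator_mem_holFunOn (fun y hy ↦ (contMDiffAt_mul_complex' (hgc y hy)
      (hsmooth _ y (h1W y hy))).sub (hsmooth _ y (h0W y hy))) fun y hy ↦ ?_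
    rw [dolbeaultBar_ofFun_mul_sub_apply hW hg (fun y hy ↦ hsmooth _ y (h1W y hy))
      (fun y hy ↦ hsmooth _ y (h0W y hy)) hy, hdbar _ y (h1W y hy), hdbar _ y (h0W y hy),
      C'.coordChange_smul_extendForm U hU hUC ρ hρ hcov hz (J 0) (J 1) ⟨h0W y hy, h1W y hy⟩, sub_self]
  set x : C'.Cochain 1 := fun J ↦ ⟨_, hxmem J⟩ with hxdef
  have hx_apply : ∀ (J : Fin 2 → κ) {y : M}, y ∈ cechSet C'.U J → (x J : M → ℂ) y =
      L.coordChange (C'.frame (J 1)) (C'.frame (J 0)) y * h (J 1) y - h (J 0) y := fun J y hy ↦ by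
    rw [hxdef]
    exact indicator_of_mem hy
      (fun y ↦ L.coordChange (C'.frame (J 1)) (C'.frame (J 0)) y * h (J 1) y - h (J 0) y)
  -- the fine `0`-cochain `w_i = h_i - b_i`
  have hwmem : ∀ J : Fin 1 → κ, (cechSet U J).indicator
      (fun y ↦ h (J 0) y - (C'.shrink U hU hUC).contract ρ z (J 0) y) ∈ holFunOn E (cechSet U J) := by
    intro J
    have hW : IsOpen (cechSet U J) := isOpen_cechSet hU J
    have h0W : ∀ y ∈ cechSet U J, y ∈ U (J 0) := fun y hy ↦ cechSet_subset_apply U J 0 hy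
    refine indicator_mem_holFunOn (fun y hy ↦ (hsmooth _ y (hUC _ (h0W y hy))).sub (hbsmooth _ y (h0W y hy)))
      fun y hy ↦ ?_
    have e := dolbeaultBar_ofFun_mul_sub_apply hW (mdifferentiableOn_const (c := (1 : ℂ)))
      (fun y hy ↦ hsmooth _ y (hUC _ (h0W y hy))) (fun y hy ↦ hbsmooth _ y (h0W y hy)) hy
    simp only [one_mul, one_smul] at e
    rw [e, hdbar _ y (hUC _ (h0W y hy)), ← (C'.shrink U hU hUC).dbarContract_apply_of_mem ρ hρ z (J 0) (h0W y hy),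
      C'.extendForm_apply_eq_dbarContract U hU hUC ρ hρ hz (J 0) (h0W y hy), sub_self]
  set w : (C'.shrink U hU hUC).Cochain 0 := fun J ↦ ⟨_, hwmem J⟩ with hwdef
  have hw_apply : ∀ (J : Fin 1 → κ) {y : M}, y ∈ cechSet U J →
      (w J : M → ℂ) y = h (J 0) y - (C'.shrink U hU hUC).contract ρ z (J 0) y := fun J y hy ↦ by
    rw [hwdef]
    exact indicator_of_mem hy (fun y ↦ h (J 0) y - (C'.shrink U hU hUC).contract ρ z (J 0) y)
  refine ⟨x, w, ?_, ?_⟩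
  · -- `x` is a cocycle
    funext J
    refine Subtype.ext (funext fun y ↦ ?_)
    by_cases hy : y ∈ cechSet C'.U J
    · have hy0 : y ∈ C'.U (J 0) := cechSet_subset_apply C'.U J 0 hy
      have hy1 : y ∈ C'.U (J 1) := cechSet_subset_apply C'.U J 1 hy
      have hy2 : y ∈ C'.U (J 2) := cechSet_subset_apply C'.U J 2 hy
      have s00 : (Fin.succAbove (0 : Fin 3)) 0 = 1 := by decide
      have s01 : (Fin.succAbove (0 : Fin 3)) 1 = 2 := by decide
      have s10 : (Fin.succAbove (1 : Fin 3)) 0 = 0 := by decide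
      have s11 : (Fin.succAbove (1 : Fin 3)) 1 = 2 := by decide
      have s20 : (Fin.succAbove (2 : Fin 3)) 0 = 0 := by decide
      have s21 : (Fin.succAbove (2 : Fin 3)) 1 = 1 := by decide
      have hf0 : y ∈ cechSet C'.U (J ∘ Fin.succAbove 0) := cechSet_subset_comp C'.U J _ hy
      have hf1 : y ∈ cechSet C'.U (J ∘ Fin.succAbove 1) := cechSet_subset_comp C'.U J _ hy
      have hf2 : y ∈ cechSet C'.U (J ∘ Fin.succAbove 2) := cechSet_subset_comp C'.U J _ hy
      have ht0 : C'.trans J (Fin.succAbove (0 : Fin 3)) y = L.coordChange (C'.frame (J 1)) (C'.frame (J 0)) y := by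
        unfold trans; rw [s00]
      have ht1 : C'.trans J (Fin.succAbove (1 : Fin 3)) y = 1 :=
        C'.trans_eq_one _ s10 hy
      have ht2 : C'.trans J (Fin.succAbove (2 : Fin 3)) y = 1 :=
        C'.trans_eq_one _ s20 hy
      have hg : L.coordChange (C'.frame (J 1)) (C'.frame (J 0)) y * L.coordChange (C'.frame (J 2)) (C'.frame (J 1)) y =
          L.coordChange (C'.frame (J 2)) (C'.frame (J 0)) y := by
        rw [mul_comm]
        exact L.coordChange_comp _ _ _ y ⟨⟨C'.subset _ hy2, C'.subset _ hy1⟩, C'.subset _ hy0⟩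
      rw [C'.delta_apply_apply_of_mem x hy, Fin.sum_univ_three, ht0, ht1, ht2, hx_apply _ hf0, hx_apply _ hf1,
        hx_apply _ hf2]
      simp only [Function.comp_apply, s00, s01, s10, s11, s20, s21, Fin.val_zero, pow_zero, Fin.val_one,
        pow_one, Fin.val_two, one_mul, Pi.zero_apply, ZeroMemClass.coe_zero]
      linear_combination (h (J 2) y) * hg
    · rw [holFunOn.apply_of_notMem _ hy]
      rfl
  · -- `x|_𝔙 = z + δ w`
    funext J
    refine Subtype.ext (funext fun y ↦ ?_)
    by_cases hy : y ∈ cechSet U J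
    · have hy0 : y ∈ U (J 0) := cechSet_subset_apply U J 0 hy
      have hy1 : y ∈ U (J 1) := cechSet_subset_apply U J 1 hy
      have s00 : (Fin.succAbove (0 : Fin 2)) 0 = 1 := by decide
      have s10 : (Fin.succAbove (1 : Fin 2)) 0 = 0 := by decide
      have hf0 : y ∈ cechSet U (J ∘ Fin.succAbove 0) := cechSet_subset_comp U J _ hy
      have hf1 : y ∈ cechSet U (J ∘ Fin.succAbove 1) := cechSet_subset_comp U J _ hy
      have ht0 : (C'.shrink U hU hUC).trans J (Fin.succAbove (0 : Fin 2)) y =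
          L.coordChange (C'.frame (J 1)) (C'.frame (J 0)) y := by
        unfold trans; rw [s00]; rfl
      have ht1 : (C'.shrink U hU hUC).trans J (Fin.succAbove (1 : Fin 2)) y = 1 :=
        (C'.shrink U hU hUC).trans_eq_one _ s10 hy
      have hJ : J = ![J 0, J 1] := by
        funext i; fin_cases i <;> rfl
      have hz_apply : (z J : M → ℂ) y = L.coordChange (C'.frame (J 1)) (C'.frame (J 0)) y *
          (C'.shrink U hU hUC).contract ρ z (J 1) y - (C'.shrink U hU hUC).contract ρ z (J 0) y := by
        rw [hJ]
        exact ((C'.shrink U hU hUC).coordChange_mul_contract_sub ρ hρ hz (J 0) (J 1) ⟨hy0, hy1⟩).symm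
      rw [C'.res_apply_apply_of_mem U hU hUC x hy, hx_apply J (cechSet_mono hUC J hy), Pi.add_apply,
        Submodule.coe_add, Pi.add_apply, hz_apply, (C'.shrink U hU hUC).delta_apply_apply_of_mem w hy,
        Fin.sum_univ_two, ht0, ht1, hw_apply _ hf0, hw_apply _ hf1]
      simp only [Function.comp_apply, s00, s10, Fin.val_zero, pow_zero, Fin.val_one, pow_one, one_mul]
      ring
    · rw [holFunOn.apply_of_notMem _ hy, holFunOn.apply_of_notMem _ hy]

end FramedCover

end HolomorphicLineBundle

end Literature.Geometry.Kaehler
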